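import Summits.ResolutionOfSingularities.ResolutionOfSingularities.Theorems.EquisingularLiftEquisingularLiftNatMemberSZeroStepSingular
import Summits.ResolutionOfSingularities.ResolutionOfSingularities.Theorems.EquisingularLiftEquisingularLiftNatInvKCLStepSingular
import HarnessLib

/-!
# [OURS · L1 W4.5(b) · EL♮(3) · T23-A″-S R-b] SHADOW-FREE arm: The (step, flag raised) clause of the inner driver at `INV := TCPlus.InvS₀` ((viii)+(ix)+(x), NO shadow):
# `invS₀_step_singular` — = `invS_step_singular` (p618612) minus the shadow

res-type-027 g18, brick (R3) of the object «A″-S UPSTAIRS TWINS» (res-L1-w45b-plan-1 desk RULING R20 (iv) / DESK WORD 2026-08-28T08:15:46Z; res-L1-w45b-stub-4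
T23-A″ ENGINE WORD 16d03a46d50c8ccd §S). OURS; NOT a statement of any manuscript ([Hironaka2017] is a candidate under adjudication, nothing of it is
asserted); AI-written, weaker than expert review. No `sorry`; standard axioms. DEF-FREE. `--supports stmt-ResolutionOfSingularities-20148 --as helper`.

WHAT. `invS₀_step_singular`: `TCPlus.InvS₀ … W G₁ β T Z S_d false` + the NON-REGULAR point `y` of the running curve, `G₁` regular at `y`, `υ₁` the
blow-up of `y` ⟹ `TCPlus.InvS₀ … W G₂ (υ₁ ≫ β) T′ Z′ S_d′ true`. PROOF = `invKCL_step_singular` verbatim (credit: res-D-pv-029 /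
res-L1-w45b-stub-1's `inv_step_singular`, res-L1-w45b-stub-4's KCL twin) with res-type-027's (C)S₀ brick (…NatMemberSZeroStepSingular).
-/

set_option linter.dupNamespace false -- mandated namespace `Summit.<Summit>.<Problem>` of this single-conjunct summit
set_option linter.overlappingInstances false -- signatures carry `[IsDomain O] [IsDiscreteValuationRing O]`

noncomputable section

open CategoryTheory CategoryTheory.Limits AlgebraicGeometry TopologicalSpace Topology IsLocalRing
open Literature.AlgebraicGeometry.Resolution
open AlgebraicGeometry.Scheme.IdealSheafData
open Summit.ResolutionOfSingularities.ResolutionOfSingularities.Theses.EquisingularLift.Split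

namespace Summit.ResolutionOfSingularities.ResolutionOfSingularities.Cruxes.EquisingularLiftNat.Sections

/-- **(step, flag raised) at `INV := TCPlus.InvS₀`** (plane trace (ix), plane flatness (x); see the module docstring).
[cite: GortzWedhorn2020, Prop. 13.91 and (13.19)] [OURS · L1 W4.5b · T23-A″-S] hypothesis (sing) of the B″-S driver in its `InvS₀` branch, brick (R3)
(stmt-ResolutionOfSingularities-20148 / -20038); NOT a statement of the manuscript. -/
theorem invS₀_step_singular (O : Type) [CommRing O] [IsDomain O] [IsDiscreteValuationRing O]
    (k : Type) [Field k] (θ : O →+* k) (hθ : Function.Surjective θ)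
    (P : Scheme.{0}) [IsIntegral P] (q : P ⟶ Spec (.of O)) [IsProper q] [SmoothOfRelativeDimension 3 q]
    (Y : Set P) (hYsp : Y ⊆ q ⁻¹' {closedPoint O}) (hYirr : IsIrreducible Y) (hYcl : IsClosed Y)
    (hPnoeth : IsLocallyNoetherian P) (hPreg : Scheme.IsRegular P)
    (Ch : ∀ X' : Scheme.{0}, (X' ⟶ P) → Set X' → Prop)
    (hChain : ∀ (X' : Scheme.{0}) (σ : X' ⟶ P) (S : Set X'), Ch X' σ S → Chain P Y X' σ S)
    (hStep : ∀ (X' X'' : Scheme.{0}) (σ' : X' ⟶ P) (S' : Set X') (C : X'.IdealSheafData) (τ : X'' ⟶ X'),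
      Ch X' σ' S' → IsBlowup τ C → Scheme.IsRegular C.subscheme → Flat (C.subschemeι ≫ σ' ≫ q) →
      σ' '' (C.support : Set X') ⊆ {x : P | ¬ IsGenericPoint x Y} →
      (C.support : Set X') ∩ (σ' ≫ q) ⁻¹' {closedPoint O} ⊆ S' →
      Ch X'' (τ ≫ σ') (closure (τ ⁻¹' (S' \ (C.support : Set X')))))
    {F₁ F₂ : Scheme.{0}} (W : Set F₁) (G₁ G₂ : Scheme.{0}) (β : G₁ ⟶ F₂) (T Z Sd : Set G₁)
    (y : ↥((vanishingIdeal (⟨closure Z, isClosed_closure⟩ : Closeds G₁))).subscheme) (υ₁ : G₂ ⟶ G₁)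
    (hy : IsClosed ({((vanishingIdeal (⟨closure Z, isClosed_closure⟩ : Closeds G₁)).subschemeι y : G₁)} : Set G₁))
    (hInv : TCPlus.InvS₀ O k θ P q Y Ch W G₁ β T Z Sd false)
    (hyT : ((vanishingIdeal (⟨closure Z, isClosed_closure⟩ : Closeds G₁)).subschemeι y : G₁) ∈ T)
    (hysing : ¬ IsRegularLocalRing
      (((vanishingIdeal (⟨closure Z, isClosed_closure⟩ : Closeds G₁))).subscheme.presheaf.stalk y))
    (_hyreg : IsRegularLocalRing
      (G₁.presheaf.stalk ((vanishingIdeal (⟨closure Z, isClosed_closure⟩ : Closeds G₁)).subschemeι y)))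
    (hυ₁ : IsBlowup υ₁ (vanishingIdeal
      ⟨{((vanishingIdeal (⟨closure Z, isClosed_closure⟩ : Closeds G₁)).subschemeι y : G₁)}, hy⟩)) :
    TCPlus.InvS₀ O k θ P q Y Ch W G₂ (υ₁ ≫ β)
      (closure (υ₁ ⁻¹' (T \ {((vanishingIdeal (⟨closure Z, isClosed_closure⟩ : Closeds G₁)).subschemeι y : G₁)})))
      (closure (υ₁ ⁻¹' (Z \ {((vanishingIdeal (⟨closure Z, isClosed_closure⟩ : Closeds G₁)).subschemeι y : G₁)})))
      (closure (υ₁ ⁻¹' (Sd \ {((vanishingIdeal (⟨closure Z, isClosed_closure⟩ : Closeds G₁)).subschemeι y : G₁)})))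
      true := by
  classical
  obtain ⟨hGint, -, -, hTZ, -, hflag⟩ := hInv
  haveI := hGint
  have hmem := hflag rfl y hy hysing
  have hxZ : ((vanishingIdeal (⟨closure Z, isClosed_closure⟩ : Closeds G₁)).subschemeι y : G₁) ∈ closure Z := by
    have h : ((vanishingIdeal (⟨closure Z, isClosed_closure⟩ : Closeds G₁)).subschemeι y : G₁) ∈
        Set.range (vanishingIdeal (⟨closure Z, isClosed_closure⟩ : Closeds G₁)).subschemeι := ⟨y, rfl⟩
    rw [Scheme.IdealSheafData.range_subschemeι, Scheme.IdealSheafData.coe_support_vanishingIdeal] at h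
    exact h
  have hTx : ¬ T ⊆ {((vanishingIdeal (⟨closure Z, isClosed_closure⟩ : Closeds G₁)).subschemeι y : G₁)} := fun h =>
    hTZ (h.trans (Set.singleton_subset_iff.mpr hxZ))
  obtain ⟨hG₂int, hT₂irr, hmem₂⟩ := memberS₀_strictTransform_of_centredPoint O k θ hθ P q Y hYsp hYirr hYcl hPnoeth hPreg Ch
    hChain hStep G₁ T Z Sd _ hy hyT hTx hmem G₂ υ₁ hυ₁
  exact ⟨hG₂int, isClosed_closure, hT₂irr, not_closure_preimage_diff_subset_of_isBlowup_point υ₁ hy hυ₁ hTZ hxZ, hmem₂,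
    fun h => Bool.noConfusion h⟩

end Summit.ResolutionOfSingularities.ResolutionOfSingularities.Cruxes.EquisingularLiftNat.Sections

end
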